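import Literature.NumberTheory.LFunctions.ThetaChainFreeCheck
import HarnessLib

/-!
# Schoenfeld's `θ`-bound on `[599, 10⁸]` by kernel computation: data-free run, chunk 24 of 35

Topic: `Literature/NumberTheory/LFunctions`. Pure proof file (a kernel computation; nothing is
asserted, no definition). The theorems below evaluate `ThetaChain.runFree` — together `150000`
data-free steps of the certified `θ`-chain (`ThetaChain.stepFree`, `ThetaChainFreeCheck.lean`: the
next prime found and certified by two gcds with the primorials of the odd primes `≤ 2999` and in
`(2999, 10007]`, the enclosures of `log p` and `θ(p)`, and the two comparisons behind
`|θ(x) − x| ≤ √x log² x/(8π)`) — from the state at the prime `68686747` to the state at the prime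
`71397713`. Soundness: `ThetaChain.runFree_sound`; assembly of the 35 chunks: `ThetaUpTo1e8.lean`.
The expected states were obtained by evaluating a twin of the same function outside the kernel
(validated bit-for-bit on the tree's chunk `ThetaChainRun.xrun14`). Declarations of `5·10⁴` steps
(about `70 s` of kernel time each; the kernel's evaluation is linear within a declaration of this size),
`decide +kernel`, standard axioms only (`maxHeartbeats 0` lifts the deterministic time-out).

## References

* L. Schoenfeld, *Sharper bounds for the Chebyshev functions θ(x) and ψ(x). II*, Math. Comp. 30
  (1976), 337–360, Thm. 10 (6.3). [Schoenfeld1976]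
* J. B. Rosser, L. Schoenfeld, *Approximate formulas for some functions of prime numbers*,
  Illinois J. Math. 6 (1962), 64–94, Thms. 18–19 (`θ`-tables to `10⁸`). [RosserSchoenfeld1962]
-/

namespace Literature.NumberTheory.LFunctions.ThetaChainRun

open ThetaChain

set_option maxHeartbeats 0 in
/-- **Data-free certified `θ`-run, chunk 24a** (steps `3450001`–`3500000` after `8886113`: 50000 primes,
`68686747` to `69588709`). [cite: Schoenfeld1976, Thm. 10 (6.3)] -/
theorem frun24a :
    runFree 50000
      ⟨68686747, 21815147204284437715757914, 21815147204284913402796881, 83027855188440445299663445545561, 83027855188442369457323427672045⟩ =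
    some ⟨69588709, 21830918920352585604886288, 21830918920353061292875920, 84119008574613995731384902557609, 84119008574615943673420598490243⟩ := by
  decide +kernel

set_option maxHeartbeats 0 in
/-- **Data-free certified `θ`-run, chunk 24b** (steps `3500001`–`3550000` after `8886113`: 50000 primes,
`69588709` to `70491313`). [cite: Schoenfeld1976, Thm. 10 (6.3)] -/
theorem frun24b :
    runFree 50000
      ⟨69588709, 21830918920352585604886288, 21830918920353061292875920, 84119008574613995731384902557609, 84119008574615943673420598490243⟩ =
    some ⟨70491313, 21846498535014305717358764, 21846498535014781406298951, 85210945463547810328947612117784, 85210945463549782055406554849338⟩ := by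
  decide +kernel

set_option maxHeartbeats 0 in
/-- **Data-free certified `θ`-run, chunk 24c** (steps `3550001`–`3600000` after `8886113`: 50000 primes,
`70491313` to `71397713`). [cite: Schoenfeld1976, Thm. 10 (6.3)] -/
theorem frun24c :
    runFree 50000
      ⟨70491313, 21846498535014305717358764, 21846498535014781406298951, 85210945463547810328947612117784, 85210945463549782055406554849338⟩ =
    some ⟨71397713, 21861944201242998620621291, 21861944201243474310511923, 86303657568706149059331068181579, 86303657568708144570260782404268⟩ := by
  decide +kernel

end Literature.NumberTheory.LFunctions.ThetaChainRun
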